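import Literature.Computability.Cryptography.NaorReingoldHybrids
import Literature.Computability.Cryptography.ModExpCircuits
import Literature.Computability.Cryptography.FiniteHybrids
import HarnessLib

/-!
# One DDH challenge per hybrid step: the non-uniform simulator of Naor–Reingold's Thm. 4.1

Continuation of `NaorReingoldHybrids.lean`. For a step `τ → τ + 1` at level `j` whose `τ`-th
string `u` IS a length-`j` prefix, the two sub-hybrid tables differ only at the inputs with prefix
`u`: there they read the pair `(g^{R(u)}, g^{R(u) a_{j+1}})` (step `τ + 1`, a Diffie–Hellman pair
with the common secret `a_{j+1}`) versus `(g^{R(u)}, g^{R(u1)})` (step `τ`, a random pair). This is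
Naor–Reingold's simulation (proof of Thm. 4.1, p. 250, step (3): answer `(g^{b})^{∏_{k>J} a_k}`
or `(g^{c̃})^{∏_{k>J} a_k}`; and Lemma 4.4, p. 249: all other Diffie–Hellman pairs share `g^a`)
made NON-UNIFORM: all the remaining randomness `ρ` (the random function off `{u, u1}`, the other
key exponents, the hash key) is FIXED, so that

* `simTable ρ A B Z` — the table as a function of a challenge `(A, B, Z) = (g^a, g^b, z)`: every
  entry is a hard-wired power of `A`, `B` or `Z`, or a constant (`subTable_glue_succ`,
  `subTable_glue`: the sub-hybrids ARE the simulated tables at `z = g^{ab}`, resp. `z = g^c`, after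
  reassembling the sample point through the equivalence `glue`);
* `exists_simCircuit` — a `B₂`-circuit of size `≤ 2ⁿ · entryCost m + |T|` computing
  `T(simTable ρ A B Z)` from the `3m` bits of the challenge (modular exponentiation by
  square-and-multiply, `HasBits.pow`; the hash bit as a masked parity);
* `abs_uProb_subTable_step_le` — hence, if every `B₂`-circuit of that size has DDH advantage
  `≤ ε` against `⟨P, Q, g⟩`, consecutive sub-hybrids are `ε`-close, and (`abs_uProb_hybTable_le`)
  levels `0` and `n` are `n · 2ⁿ · ε`-close ("advantage `ε(n)/n`" of the printed uniform
  reduction becomes `ε · n 2ⁿ` for truth-table adversaries, which query all `2ⁿ` points).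

## References

* M. Naor, O. Reingold, J. ACM 51 (2004), Thm. 4.1 and its proof (pp. 245–251), Lemma 4.4.
* S. Arora, B. Barak, *Computational Complexity: A Modern Approach*, CUP 2009, §23.3 and
  Thm. 9.11 (hybrid arguments with non-uniform advice).
-/

noncomputable section

namespace Literature.Computability.Cryptography

open Finset Literature.Computability.MetaComplexity Literature.Computability.Complexity
  Literature.Computability.AlgebraicComplexity

namespace NaorReingold

namespace Params

variable (pp : Params)

/-! ### Reassembling the sample space around one challenge -/

/-- The randomness that is FIXED in one step: the random function off the two positions
`p₁ = u`, `p₂ = u1`, the key exponents other than `a_{j+1}`, and the hash key. [cite: NaorReingold2004, proof of Thm. 4.1 (p. 250, step (2): "sample … a_{J+1}, …, a_n")] -/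
abbrev Rest (j : Fin pp.n) (p₁ p₂ : Fin (2 ^ pp.n)) : Type :=
  ({p : Fin (2 ^ pp.n) // p ≠ p₁ ∧ p ≠ p₂} → Fin pp.Q) × ({i : Fin (pp.n + 1) // i ≠ j.succ} → Fin pp.Q) ×
    (Fin pp.m → Bool)

/-- Inserting two values into a function given off two positions. [folklore] -/
def fill₂ {p₁ p₂ : Fin (2 ^ pp.n)} (β γ : Fin pp.Q) (R' : {p : Fin (2 ^ pp.n) // p ≠ p₁ ∧ p ≠ p₂} → Fin pp.Q) :
    Fin (2 ^ pp.n) → Fin pp.Q :=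
  fun p => if h₁ : p = p₁ then β else if h₂ : p = p₂ then γ else R' ⟨p, h₁, h₂⟩

/-- Inserting one value into a function given off one position. [folklore] -/
def fill₁ {i₀ : Fin (pp.n + 1)} (α : Fin pp.Q) (a' : {i : Fin (pp.n + 1) // i ≠ i₀} → Fin pp.Q) :
    Fin (pp.n + 1) → Fin pp.Q :=
  fun i => if h : i = i₀ then α else a' ⟨i, h⟩

variable {pp}

/-- `fill₂` at the first position. [folklore] -/
theorem fill₂_apply_left {p₁ p₂ : Fin (2 ^ pp.n)} (β γ : Fin pp.Q) (R' : {p : Fin (2 ^ pp.n) // p ≠ p₁ ∧ p ≠ p₂} → Fin pp.Q) :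
    pp.fill₂ β γ R' p₁ = β := by simp [fill₂]

/-- `fill₂` at the second position. [folklore] -/
theorem fill₂_apply_right {p₁ p₂ : Fin (2 ^ pp.n)} (hp : p₁ ≠ p₂) (β γ : Fin pp.Q)
    (R' : {p : Fin (2 ^ pp.n) // p ≠ p₁ ∧ p ≠ p₂} → Fin pp.Q) : pp.fill₂ β γ R' p₂ = γ := by
  simp [fill₂, hp.symm]

/-- `fill₂` off the two positions. [folklore] -/
theorem fill₂_apply_of_ne {p₁ p₂ : Fin (2 ^ pp.n)} (β γ : Fin pp.Q) (R' : {p : Fin (2 ^ pp.n) // p ≠ p₁ ∧ p ≠ p₂} → Fin pp.Q)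
    {p : Fin (2 ^ pp.n)} (h₁ : p ≠ p₁) (h₂ : p ≠ p₂) : pp.fill₂ β γ R' p = R' ⟨p, h₁, h₂⟩ := by
  simp [fill₂, h₁, h₂]

/-- `fill₁` at the position. [folklore] -/
theorem fill₁_apply_self {i₀ : Fin (pp.n + 1)} (α : Fin pp.Q) (a' : {i : Fin (pp.n + 1) // i ≠ i₀} → Fin pp.Q) :
    pp.fill₁ α a' i₀ = α := by simp [fill₁]

/-- `fill₁` off the position. [folklore] -/
theorem fill₁_apply_of_ne {i₀ : Fin (pp.n + 1)} (α : Fin pp.Q) (a' : {i : Fin (pp.n + 1) // i ≠ i₀} → Fin pp.Q)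
    {i : Fin (pp.n + 1)} (h : i ≠ i₀) : pp.fill₁ α a' i = a' ⟨i, h⟩ := by simp [fill₁, h]

variable (pp)

/-- **Reassembly**: a sample point `(R, a, r)` is the same as the challenge exponents
`(α, β, γ) = (a_{j+1}, R p₁, R p₂)` together with the rest. [cite: NaorReingold2004, proof of Thm. 4.1 (pp. 250–251)] -/
def glue (j : Fin pp.n) (p₁ p₂ : Fin (2 ^ pp.n)) (hp : p₁ ≠ p₂) :
    (Fin pp.Q × Fin pp.Q × Fin pp.Q) × pp.Rest j p₁ p₂ ≃ pp.HΩ where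
  toFun q := (pp.fill₂ q.1.2.1 q.1.2.2 q.2.1, pp.fill₁ q.1.1 q.2.2.1, q.2.2.2)
  invFun ω := ((ω.2.1 j.succ, ω.1 p₁, ω.1 p₂), (fun q => ω.1 q.val, fun q => ω.2.1 q.val, ω.2.2))
  left_inv q := by
    obtain ⟨⟨α, β, γ⟩, R', a', r⟩ := q
    simp only [fill₂_apply_left, fill₂_apply_right hp, fill₁_apply_self]
    refine Prod.ext rfl (Prod.ext ?_ (Prod.ext ?_ rfl))
    · funext q
      exact fill₂_apply_of_ne β γ R' q.prop.1 q.prop.2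
    · funext q
      exact fill₁_apply_of_ne α a' q.prop
  right_inv ω := by
    obtain ⟨R, a, r⟩ := ω
    refine Prod.ext ?_ (Prod.ext ?_ rfl)
    · funext p
      by_cases h₁ : p = p₁
      · subst h₁; simp [fill₂]
      · by_cases h₂ : p = p₂
        · subst h₂; simp [fill₂, h₁]
        · simp [fill₂, h₁, h₂]
    · funext i
      by_cases h : i = j.succ
      · subst h; simp [fill₁]
      · simp [fill₁, h]

/-! ### The simulated table -/

/-- The fixed part of the random function, extended by a junk value on the two challenge
positions (never read there). [folklore] -/
def restR {j : Fin pp.n} {p₁ p₂ : Fin (2 ^ pp.n)} (ρ : pp.Rest j p₁ p₂) (p : Fin (2 ^ pp.n)) : Fin pp.Q :=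
  if h : p ≠ p₁ ∧ p ≠ p₂ then ρ.1 ⟨p, h⟩ else ⟨0, pp.Q_pos⟩

/-- The fixed part of the key, extended by a junk value at `j + 1` (never read by `prodFrom (j+1)`). [folklore] -/
def restKey {j : Fin pp.n} {p₁ p₂ : Fin (2 ^ pp.n)} (ρ : pp.Rest j p₁ p₂) : Fin (pp.n + 1) → ℕ :=
  pp.natKey (pp.fill₁ ⟨0, pp.Q_pos⟩ ρ.2.1)

/-- **The simulated entry** at input `x` for the step `(j, τ)` with active prefix `u`, as a function
of the challenge `(A, B, Z) = (g^a, g^b, z)` (NR p. 250, step (3), with all other randomness `ρ`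
hard-wired): inputs with prefix `u` read `B` (bit `x_j = 0`) or `Z` (bit `x_j = 1`) raised to the
remaining product; coupled inputs read the corresponding power of `A`; all others are constants.
[cite: NaorReingold2004, proof of Thm. 4.1 (p. 250, step (3)) and Lemma 4.4 (p. 249)] -/
def simEntry (j : Fin pp.n) (τ : ℕ) (u : Fin pp.n → Bool) {p₁ p₂ : Fin (2 ^ pp.n)} (ρ : pp.Rest j p₁ p₂)
    (A B Z : ZMod pp.P) (x : Fin pp.n → Bool) : ZMod pp.P :=
  if pp.mask j.val x = u then
    (if x j then Z else B) ^ (pp.prodFrom (j.val + 1) (pp.restKey ρ) x % pp.Q)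
  else if x j = true ∧ (pp.idx (pp.mask j.val x)).val < τ then
    A ^ ((pp.restR ρ (pp.idx (pp.mask j.val x))).val * pp.prodFrom (j.val + 1) (pp.restKey ρ) x % pp.Q)
  else pp.gpow ((pp.restR ρ (pp.idx (pp.mask (j.val + 1) x))).val * pp.prodFrom (j.val + 1) (pp.restKey ρ) x)

/-- The simulated table handed to the distinguisher. [cite: NaorReingold2004, proof of Thm. 4.1 (p. 250, step (3))] -/
def simTable (j : Fin pp.n) (τ : ℕ) (u : Fin pp.n → Bool) {p₁ p₂ : Fin (2 ^ pp.n)} (ρ : pp.Rest j p₁ p₂)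
    (A B Z : ZMod pp.P) : Fin (2 ^ pp.n) → Bool :=
  fun t => pp.hashBit ρ.2.2 (pp.simEntry j τ u ρ A B Z (pp.idx.symm t))

variable {pp}

/-- Powers of `g` only depend on the exponent modulo `Q` once `g^Q = 1`. [folklore] -/
theorem gpow_eq_gpow_mod (hg : pp.gpow pp.Q = 1) (e : ℕ) : pp.gpow e = pp.gpow (e % pp.Q) := by
  unfold gpow at hg ⊢
  conv_lhs => rw [← Nat.div_add_mod e pp.Q, pow_add, pow_mul, hg, one_pow, one_mul]

/-- `(g^c)^{k mod Q} = g^{c k}` once `g^Q = 1`. [folklore] -/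
theorem gpow_pow_mod (hg : pp.gpow pp.Q = 1) (c k : ℕ) : pp.gpow c ^ (k % pp.Q) = pp.gpow (c * k) := by
  rw [gpow_eq_gpow_mod hg (c * k), gpow, gpow, ← pow_mul, ← gpow, ← gpow, gpow_eq_gpow_mod hg (c * (k % pp.Q)),
    Nat.mul_mod, Nat.mod_mod, ← Nat.mul_mod]

/-- The glued key agrees with the fixed key off `j + 1`, so the remaining products agree. [folklore] -/
theorem prodFrom_glue {j : Fin pp.n} {p₁ p₂ : Fin (2 ^ pp.n)} (α : Fin pp.Q) (ρ : pp.Rest j p₁ p₂)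
    (x : Fin pp.n → Bool) :
    pp.prodFrom (j.val + 1) (pp.natKey (pp.fill₁ α ρ.2.1)) x = pp.prodFrom (j.val + 1) (pp.restKey ρ) x := by
  refine prodFrom_congr x fun i hi => ?_
  have hne : i.succ ≠ j.succ := fun h => by
    have := Fin.succ_inj.1 h
    subst this
    simp at hi
  simp [natKey, restKey, fill₁_apply_of_ne _ _ hne]

/-- The glued random function agrees with the fixed one off `{p₁, p₂}`. [folklore] -/
theorem fill₂_eq_restR {j : Fin pp.n} {p₁ p₂ : Fin (2 ^ pp.n)} (β γ : Fin pp.Q) (ρ : pp.Rest j p₁ p₂)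
    {p : Fin (2 ^ pp.n)} (h₁ : p ≠ p₁) (h₂ : p ≠ p₂) : pp.fill₂ β γ ρ.1 p = pp.restR ρ p := by
  rw [fill₂_apply_of_ne β γ ρ.1 h₁ h₂, restR, dif_pos ⟨h₁, h₂⟩]

/-- **The sub-hybrid `τ + 1` is the simulation at a Diffie–Hellman challenge** `(g^α, g^β, g^{αβ})`
(after reassembly of the sample point; `u` the active `τ`-th prefix, `p₁ = u`, `p₂ = u1`).
[cite: NaorReingold2004, proof of Thm. 4.1 (p. 251: "Pr[D(IPR) = 1 | J = j] …")] -/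
theorem subTable_glue_succ (hg : pp.gpow pp.Q = 1) (j : Fin pp.n) {τ : ℕ} (hτ : τ < 2 ^ pp.n)
    {u : Fin pp.n → Bool} (hu : pp.idx.symm ⟨τ, hτ⟩ = u) (huj : pp.mask j.val u = u)
    (hp : pp.idx u ≠ pp.idx (Function.update u j true))
    (q : (Fin pp.Q × Fin pp.Q × Fin pp.Q) × pp.Rest j (pp.idx u) (pp.idx (Function.update u j true))) :
    pp.subTable j (τ + 1) (pp.glue j _ _ hp q) =
      pp.simTable j τ u q.2 (pp.gpow q.1.1.val) (pp.gpow q.1.2.1.val) (pp.gpow (q.1.1.val * q.1.2.1.val)) := by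
  obtain ⟨⟨α, β, γ⟩, ρ⟩ := q
  funext t
  simp only [subTable, simTable, glue, Equiv.coe_fn_mk]
  congr 1
  set x := pp.idx.symm t with hx
  simp only [simEntry]
  by_cases hm : pp.mask j.val x = u
  · rw [if_pos hm]
    cases hxj : x j
    · rw [subExp_at_prefix_false j (τ + 1) hm hxj, prodFrom_glue, fill₂_apply_left]
      simp only [Bool.false_eq_true, if_false]
      rw [gpow_pow_mod hg]
    · rw [(subExp_at_prefix_true j hτ hu hm hxj _ _).1, prodFrom_glue, fill₂_apply_left, fill₁_apply_self]
      simp only [if_true]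
      rw [gpow_pow_mod hg]
      congr 1
      ring
  · rw [if_neg hm]
    by_cases hc : x j = true ∧ (pp.idx (pp.mask j.val x)).val < τ
    · obtain ⟨h1, h2, h3⟩ := subExp_of_coupled j hτ hu hm hc.1 hc.2 (Or.inr rfl) (pp.fill₂ β γ ρ.1) (pp.fill₁ α ρ.2.1)
      rw [if_pos hc, h1, prodFrom_glue, fill₂_eq_restR β γ ρ h2 h3, fill₁_apply_self, gpow_pow_mod hg]
      congr 1
      ring
    · obtain ⟨h1, h2, h3⟩ := subExp_of_free j hτ hu huj hm hc (Or.inr rfl) (pp.fill₂ β γ ρ.1) (pp.fill₁ α ρ.2.1)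
      rw [if_neg hc, h1, prodFrom_glue, fill₂_eq_restR β γ ρ h2 h3]

/-- **The sub-hybrid `τ` is the simulation at a random challenge** `(g^α, g^β, g^γ)`. [cite: NaorReingold2004, proof of Thm. 4.1 (p. 251: "Pr[D(IR) = 1 | J = j] …")] -/
theorem subTable_glue (hg : pp.gpow pp.Q = 1) (j : Fin pp.n) {τ : ℕ} (hτ : τ < 2 ^ pp.n)
    {u : Fin pp.n → Bool} (hu : pp.idx.symm ⟨τ, hτ⟩ = u) (huj : pp.mask j.val u = u)
    (hp : pp.idx u ≠ pp.idx (Function.update u j true))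
    (q : (Fin pp.Q × Fin pp.Q × Fin pp.Q) × pp.Rest j (pp.idx u) (pp.idx (Function.update u j true))) :
    pp.subTable j τ (pp.glue j _ _ hp q) =
      pp.simTable j τ u q.2 (pp.gpow q.1.1.val) (pp.gpow q.1.2.1.val) (pp.gpow q.1.2.2.val) := by
  obtain ⟨⟨α, β, γ⟩, ρ⟩ := q
  funext t
  simp only [subTable, simTable, glue, Equiv.coe_fn_mk]
  congr 1
  set x := pp.idx.symm t with hx
  simp only [simEntry]
  by_cases hm : pp.mask j.val x = u
  · rw [if_pos hm]
    cases hxj : x j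
    · rw [subExp_at_prefix_false j τ hm hxj, prodFrom_glue, fill₂_apply_left]
      simp only [Bool.false_eq_true, if_false]
      rw [gpow_pow_mod hg]
    · rw [(subExp_at_prefix_true j hτ hu hm hxj _ _).2, prodFrom_glue, fill₂_apply_right hp]
      simp only [if_true]
      rw [gpow_pow_mod hg]
  · rw [if_neg hm]
    by_cases hc : x j = true ∧ (pp.idx (pp.mask j.val x)).val < τ
    · obtain ⟨h1, h2, h3⟩ := subExp_of_coupled j hτ hu hm hc.1 hc.2 (Or.inl rfl) (pp.fill₂ β γ ρ.1) (pp.fill₁ α ρ.2.1)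
      rw [if_pos hc, h1, prodFrom_glue, fill₂_eq_restR β γ ρ h2 h3, fill₁_apply_self, gpow_pow_mod hg]
      congr 1
      ring
    · obtain ⟨h1, h2, h3⟩ := subExp_of_free j hτ hu huj hm hc (Or.inl rfl) (pp.fill₂ β γ ρ.1) (pp.fill₁ α ρ.2.1)
      rw [if_neg hc, h1, prodFrom_glue, fill₂_eq_restR β γ ρ h2 h3]

/-! ### The simulator as a circuit -/

variable (pp)

/-- A DDH challenge `(A, B, Z)`. [cite: NaorReingold2004, Assumption 3.1 (p. 243)] -/
abbrev Chal : Type := Fin 3 → ZMod pp.P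

/-- The `3m` input bits of a DDH adversary (the tree's `ddhEncode`). [cite: NaorReingold2004, Assumption 3.1 (p. 243)] -/
def chalBus : pp.Chal → (Fin 3 × Fin pp.m → Bool) := fun t => ddhEncode pp.m pp.P t

/-- Gates per table entry: one modular exponentiation by a hard-wired `m`-bit exponent and one
masked parity. [folklore] -/
def entryCost : ℕ := powCost pp.m pp.m + pp.m + 1

/-- Size of the DDH adversary built from a distinguisher `T`: the simulated table plus `T`. [cite: NaorReingold2004, Thm. 4.1 ("running time `poly(n) · t(n)`", p. 246)] -/
def simSize (T : Circuit (Fin (2 ^ pp.n))) : ℕ := 2 ^ pp.n * pp.entryCost + T.size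

variable {pp}

/-- The hashed bit is a masked parity of the bits of the residue. [folklore] -/
theorem hashBit_eq_maskedParity (r : Fin pp.m → Bool) (u : ZMod pp.P) :
    pp.hashBit r u = maskedParity (List.finRange pp.m) r (testBits pp.m u.val) := by
  rw [maskedParity_finRange_eq_bodd, hashBit, innerBit, card_filter_band_eq_sum]
  rfl

/-- The challenge elements are on the bus. [folklore] -/
theorem hasBits_chal [NeZero pp.P] (c : Fin 3) : HasBits pp.m pp.chalBus (fun t => t c) 0 :=
  HasBits.ofWires (fun i => (c, i)) fun _ _ => rfl

/-- **One entry of the form `⟨r, bin(X^k)⟩`** for a challenge element `X` and a hard-wired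
exponent `k < 2^m` costs `entryCost` gates. [cite: NaorReingold2004, proof of Thm. 4.1 (p. 250, step (3))] -/
theorem cktSizeVia_hashBit_pow [NeZero pp.P] (hP : pp.P ≤ 2 ^ pp.m) (r : Fin pp.m → Bool) (c : Fin 3) {k : ℕ}
    (hk : k < 2 ^ pp.m) :
    CktSizeVia pp.chalBus (fun t (_ : Unit) => pp.hashBit r ((t c) ^ k)) pp.entryCost := by
  have h1 : HasBits pp.m pp.chalBus (fun t => (t c) ^ k) (0 + powCost pp.m pp.m) :=
    HasBits.pow hP (hasBits_chal c) hk
  have h2 := h1.trans (CktSizeVia.maskedParity _ r (List.finRange pp.m))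
  refine (h2.congr fun t => ?_).of_le ?_
  · funext u
    rw [hashBit_eq_maskedParity]
  · simp only [entryCost, List.length_finRange]
    omega

/-- A constant entry costs at most `entryCost` gates. [folklore] -/
theorem cktSizeVia_const_bit (b : Bool) : CktSizeVia pp.chalBus (fun _ (_ : Unit) => b) pp.entryCost :=
  (CktSizeVia.of_cktSize (cktSize_const _ b) fun _ => rfl).of_le (by simp [entryCost])

/-- **Every simulated entry is computed from the challenge bits by `entryCost` gates.** [cite: NaorReingold2004, proof of Thm. 4.1 (p. 250, step (3))] -/
theorem cktSizeVia_simEntry [NeZero pp.P] (hP : pp.P ≤ 2 ^ pp.m) (hQ : pp.Q ≤ 2 ^ pp.m)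
    (j : Fin pp.n) (τ : ℕ) (u : Fin pp.n → Bool) {p₁ p₂ : Fin (2 ^ pp.n)} (ρ : pp.Rest j p₁ p₂) (x : Fin pp.n → Bool) :
    CktSizeVia pp.chalBus (fun t (_ : Unit) => pp.hashBit ρ.2.2 (pp.simEntry j τ u ρ (t 0) (t 1) (t 2) x)) pp.entryCost := by
  have hmod : ∀ k : ℕ, k % pp.Q < 2 ^ pp.m := fun k => (Nat.mod_lt k pp.Q_pos).trans_le hQ
  by_cases hm : pp.mask j.val x = u
  · cases hxj : x j
    · refine (cktSizeVia_hashBit_pow hP ρ.2.2 1 (hmod (pp.prodFrom (j.val + 1) (pp.restKey ρ) x))).congr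
        fun t => ?_
      funext i
      simp [simEntry, hm, hxj]
    · refine (cktSizeVia_hashBit_pow hP ρ.2.2 2 (hmod (pp.prodFrom (j.val + 1) (pp.restKey ρ) x))).congr
        fun t => ?_
      funext i
      simp [simEntry, hm, hxj]
  · by_cases hc : x j = true ∧ (pp.idx (pp.mask j.val x)).val < τ
    · refine (cktSizeVia_hashBit_pow hP ρ.2.2 0
        (hmod ((pp.restR ρ (pp.idx (pp.mask j.val x))).val * pp.prodFrom (j.val + 1) (pp.restKey ρ) x))).congr
        fun t => ?_
      funext i
      simp only [simEntry, hm, if_false, hc, and_self, if_true]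
    · refine (cktSizeVia_const_bit (pp.hashBit ρ.2.2
        (pp.gpow ((pp.restR ρ (pp.idx (pp.mask (j.val + 1) x))).val * pp.prodFrom (j.val + 1) (pp.restKey ρ) x)))).congr
        fun t => ?_
      funext i
      simp only [simEntry, hm, if_false, hc]

/-- **The whole simulated table** costs `2ⁿ · entryCost` gates. [cite: NaorReingold2004, proof of Thm. 4.1 (p. 250)] -/
theorem cktSizeVia_simTable [NeZero pp.P] (hP : pp.P ≤ 2 ^ pp.m) (hQ : pp.Q ≤ 2 ^ pp.m)
    (j : Fin pp.n) (τ : ℕ) (u : Fin pp.n → Bool) {p₁ p₂ : Fin (2 ^ pp.n)} (ρ : pp.Rest j p₁ p₂) :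
    CktSizeVia pp.chalBus (fun t => pp.simTable j τ u ρ (t 0) (t 1) (t 2)) (2 ^ pp.n * pp.entryCost) := by
  have h0 : ∀ t : Fin (2 ^ pp.n), CktSizeVia pp.chalBus
      (fun tr (_ : Unit) => pp.simTable j τ u ρ (tr 0) (tr 1) (tr 2) t) pp.entryCost := by
    intro t
    exact cktSizeVia_simEntry hP hQ j τ u ρ (pp.idx.symm t)
  have h := CktSizeVia.pi_const (κ := Fin (2 ^ pp.n)) (e := pp.chalBus)
    (f := fun tr => pp.simTable j τ u ρ (tr 0) (tr 1) (tr 2)) h0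
  rw [Fintype.card_fin] at h
  exact h

/-- **The DDH adversary**: a `B₂`-circuit of size `≤ simSize T` that, on the encoded challenge
`(A, B, Z)`, outputs `T` of the simulated table (Naor–Reingold's algorithm `D` of p. 250 composed
with `A` of Lemma 4.4, with the oracle machine replaced by a truth-table test and all sampling
hard-wired). [cite: NaorReingold2004, proof of Thm. 4.1 (pp. 249–251)] -/
theorem exists_simCircuit [NeZero pp.P] (hP : pp.P ≤ 2 ^ pp.m) (hQ : pp.Q ≤ 2 ^ pp.m)
    (j : Fin pp.n) (τ : ℕ) (u : Fin pp.n → Bool) {p₁ p₂ : Fin (2 ^ pp.n)} (ρ : pp.Rest j p₁ p₂)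
    (T : Circuit (Fin (2 ^ pp.n))) (hT : T.IsOver B2) :
    ∃ C : Circuit (Fin 3 × Fin pp.m), C.IsOver B2 ∧ C.size ≤ pp.simSize T ∧
      ∀ t : pp.Chal, C.eval (pp.chalBus t) = T.eval (pp.simTable j τ u ρ (t 0) (t 1) (t 2)) := by
  have h1 := cktSizeVia_simTable hP hQ j τ u ρ
  have h2 : CktSizeVia (fun tr : pp.Chal => pp.simTable j τ u ρ (tr 0) (tr 1) (tr 2))
      (fun tr (_ : Unit) => T.eval (pp.simTable j τ u ρ (tr 0) (tr 1) (tr 2))) T.size :=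
    CktSizeVia.of_cktSize (T.cktSize_eval hT) fun _ => rfl
  obtain ⟨C, hC, hs, hev⟩ := CktSizeVia.exists_circuit (h1.trans h2)
  exact ⟨C, hC, hs, hev⟩

/-! ### One step costs one DDH advantage -/

/-- The acceptance count of the adversary on Diffie–Hellman triples is the tree's `ddhRealAccept`. [cite: NaorReingold2004, Assumption 3.1 (p. 243)] -/
theorem uProb_sim_real {C : Circuit (Fin 3 × Fin pp.m)} {F : ZMod pp.P → ZMod pp.P → ZMod pp.P → Bool}
    (hev : ∀ t : pp.Chal, C.eval (pp.chalBus t) = F (t 0) (t 1) (t 2)) :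
    uProb (fun abc : Fin pp.Q × Fin pp.Q × Fin pp.Q =>
      F (pp.gpow abc.1.val) (pp.gpow abc.2.1.val) (pp.gpow (abc.1.val * abc.2.1.val))) =
      (ddhRealAccept pp.m pp.P pp.Q pp.g C : ℝ) / (pp.Q : ℝ) ^ 2 := by
  rw [← uProb_comp_equiv (Equiv.prodAssoc (Fin pp.Q) (Fin pp.Q) (Fin pp.Q))]
  simp only [Equiv.prodAssoc_apply]
  have h1 : uProb (fun p : (Fin pp.Q × Fin pp.Q) × Fin pp.Q =>
      F (pp.gpow p.1.1.val) (pp.gpow p.1.2.val) (pp.gpow (p.1.1.val * p.1.2.val))) =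
      uProb (fun ab : Fin pp.Q × Fin pp.Q => F (pp.gpow ab.1.val) (pp.gpow ab.2.val) (pp.gpow (ab.1.val * ab.2.val))) :=
    uProb_fst (Ω' := Fin pp.Q) fun ab : Fin pp.Q × Fin pp.Q =>
      F (pp.gpow ab.1.val) (pp.gpow ab.2.val) (pp.gpow (ab.1.val * ab.2.val))
  rw [h1]
  have hcount : (univ.filter fun ab : Fin pp.Q × Fin pp.Q =>
      F (pp.gpow ab.1.val) (pp.gpow ab.2.val) (pp.gpow (ab.1.val * ab.2.val)) = true) =
      univ.filter fun ab : Fin pp.Q × Fin pp.Q => C.eval (ddhEncode pp.m pp.P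
        ![(pp.g : ZMod pp.P) ^ (ab.1 : ℕ), (pp.g : ZMod pp.P) ^ (ab.2 : ℕ),
          (pp.g : ZMod pp.P) ^ ((ab.1 : ℕ) * (ab.2 : ℕ))]) = true := by
    ext ab
    simp only [mem_filter, mem_univ, true_and]
    rw [show ddhEncode pp.m pp.P ![(pp.g : ZMod pp.P) ^ (ab.1 : ℕ), (pp.g : ZMod pp.P) ^ (ab.2 : ℕ),
        (pp.g : ZMod pp.P) ^ ((ab.1 : ℕ) * (ab.2 : ℕ))] = pp.chalBus ![pp.gpow ab.1.val, pp.gpow ab.2.val,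
        pp.gpow (ab.1.val * ab.2.val)] from rfl, hev]
    simp
  unfold uProb ddhRealAccept
  rw [hcount, Fintype.card_prod, Fintype.card_fin, Nat.cast_mul, sq]

/-- The acceptance count of the adversary on random triples is the tree's `ddhRandAccept`. [cite: NaorReingold2004, Assumption 3.1 (p. 243)] -/
theorem uProb_sim_rand {C : Circuit (Fin 3 × Fin pp.m)} {F : ZMod pp.P → ZMod pp.P → ZMod pp.P → Bool}
    (hev : ∀ t : pp.Chal, C.eval (pp.chalBus t) = F (t 0) (t 1) (t 2)) :
    uProb (fun abc : Fin pp.Q × Fin pp.Q × Fin pp.Q =>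
      F (pp.gpow abc.1.val) (pp.gpow abc.2.1.val) (pp.gpow abc.2.2.val)) =
      (ddhRandAccept pp.m pp.P pp.Q pp.g C : ℝ) / (pp.Q : ℝ) ^ 3 := by
  have hcount : (univ.filter fun abc : Fin pp.Q × Fin pp.Q × Fin pp.Q =>
      F (pp.gpow abc.1.val) (pp.gpow abc.2.1.val) (pp.gpow abc.2.2.val) = true) =
      univ.filter fun abc : Fin pp.Q × Fin pp.Q × Fin pp.Q => C.eval (ddhEncode pp.m pp.P
        ![(pp.g : ZMod pp.P) ^ (abc.1 : ℕ), (pp.g : ZMod pp.P) ^ (abc.2.1 : ℕ),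
          (pp.g : ZMod pp.P) ^ (abc.2.2 : ℕ)]) = true := by
    ext abc
    simp only [mem_filter, mem_univ, true_and]
    rw [show ddhEncode pp.m pp.P ![(pp.g : ZMod pp.P) ^ (abc.1 : ℕ), (pp.g : ZMod pp.P) ^ (abc.2.1 : ℕ),
        (pp.g : ZMod pp.P) ^ (abc.2.2 : ℕ)] = pp.chalBus ![pp.gpow abc.1.val, pp.gpow abc.2.1.val,
        pp.gpow abc.2.2.val] from rfl, hev]
    simp
  unfold uProb ddhRandAccept
  rw [hcount, Fintype.card_prod, Fintype.card_prod, Fintype.card_fin, Nat.cast_mul, Nat.cast_mul]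
  rw [show ((pp.Q : ℝ)) ^ 3 = pp.Q * (pp.Q * pp.Q) by ring]

/-- **One sub-hybrid step is bounded by the DDH advantage of the simulator**: if every
`B₂`-circuit of size `≤ simSize T` has advantage `≤ ε` against `⟨P, Q, g⟩`, then
`|Pr[T(sub-hybrid τ+1)] - Pr[T(sub-hybrid τ)]| ≤ ε` (average over the fixed randomness `ρ` of the
advantage of the circuit `T ∘ sim_ρ`). [cite: NaorReingold2004, proof of Thm. 4.1 and Lemma 4.4 (pp. 249–251)] -/
theorem abs_uProb_subTable_step_le [NeZero pp.P] (hP : pp.P ≤ 2 ^ pp.m) (hQ : pp.Q ≤ 2 ^ pp.m)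
    (hg : pp.gpow pp.Q = 1) (T : Circuit (Fin (2 ^ pp.n))) (hT : T.IsOver B2) {ε : ℝ} (hε : 0 ≤ ε)
    (H : ∀ C : Circuit (Fin 3 × Fin pp.m), C.IsOver B2 → C.size ≤ pp.simSize T →
      ddhAdvantage pp.m pp.P pp.Q pp.g C ≤ ε)
    (j : Fin pp.n) {τ : ℕ} (hτ : τ < 2 ^ pp.n) :
    |uProb (fun ω : pp.HΩ => T.eval (pp.subTable j (τ + 1) ω)) -
      uProb (fun ω : pp.HΩ => T.eval (pp.subTable j τ ω))| ≤ ε := by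
  set u := pp.idx.symm ⟨τ, hτ⟩ with hu_def
  by_cases huj : pp.mask j.val u = u
  · -- active step: reassemble around the challenge
    have hp : pp.idx u ≠ pp.idx (Function.update u j true) := by
      intro h
      have := congrFun (pp.idx.injective h) j
      rw [apply_self_of_mask_eq huj] at this
      simp at this
    rw [← uProb_comp_equiv (pp.glue j _ _ hp) (fun ω : pp.HΩ => T.eval (pp.subTable j (τ + 1) ω)),
      ← uProb_comp_equiv (pp.glue j _ _ hp) (fun ω : pp.HΩ => T.eval (pp.subTable j τ ω))]
    simp only [subTable_glue_succ hg j hτ hu_def.symm huj hp, subTable_glue hg j hτ hu_def.symm huj hp]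
    refine abs_uProb_prod_sub_le' hε fun ρ => ?_
    dsimp only
    obtain ⟨C, hC, hsize, hev⟩ := exists_simCircuit hP hQ j τ u ρ T hT
    have h := H C hC hsize
    unfold ddhAdvantage at h
    have e1 : uProb (fun abc : Fin pp.Q × Fin pp.Q × Fin pp.Q => T.eval (pp.simTable j τ u ρ
        (pp.gpow abc.1.val) (pp.gpow abc.2.1.val) (pp.gpow (abc.1.val * abc.2.1.val)))) =
        (ddhRealAccept pp.m pp.P pp.Q pp.g C : ℝ) / (pp.Q : ℝ) ^ 2 :=
      uProb_sim_real (F := fun A B Z => T.eval (pp.simTable j τ u ρ A B Z)) hev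
    have e2 : uProb (fun abc : Fin pp.Q × Fin pp.Q × Fin pp.Q => T.eval (pp.simTable j τ u ρ
        (pp.gpow abc.1.val) (pp.gpow abc.2.1.val) (pp.gpow abc.2.2.val))) =
        (ddhRandAccept pp.m pp.P pp.Q pp.g C : ℝ) / (pp.Q : ℝ) ^ 3 :=
      uProb_sim_rand (F := fun A B Z => T.eval (pp.simTable j τ u ρ A B Z)) hev
    rw [e1, e2]
    exact h
  · -- inactive step: the two tables coincide
    have heq : ∀ ω : pp.HΩ, pp.subTable j (τ + 1) ω = pp.subTable j τ ω := fun ω =>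
      funext fun t => by simp only [subTable, subExp_succ_of_inactive j hτ huj]
    simp only [heq, sub_self, abs_zero]
    exact hε

/-- **One level**: `|Pr[T(hybrid j)] - Pr[T(hybrid j+1)]| ≤ 2ⁿ · ε`. [cite: NaorReingold2004, proof of Thm. 4.1 (p. 251)] -/
theorem abs_uProb_hybTable_succ_le [NeZero pp.P] (hP : pp.P ≤ 2 ^ pp.m) (hQ : pp.Q ≤ 2 ^ pp.m)
    (hg : pp.gpow pp.Q = 1) (T : Circuit (Fin (2 ^ pp.n))) (hT : T.IsOver B2) {ε : ℝ} (hε : 0 ≤ ε)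
    (H : ∀ C : Circuit (Fin 3 × Fin pp.m), C.IsOver B2 → C.size ≤ pp.simSize T →
      ddhAdvantage pp.m pp.P pp.Q pp.g C ≤ ε)
    (j : Fin pp.n) :
    |uProb (fun ω : pp.HΩ => T.eval (pp.hybTable j.val ω)) -
      uProb (fun ω : pp.HΩ => T.eval (pp.hybTable (j.val + 1) ω))| ≤ (2 ^ pp.n : ℕ) * ε := by
  have hN : (fun ω : pp.HΩ => T.eval (pp.hybTable j.val ω)) = fun ω => T.eval (pp.subTable j (2 ^ pp.n) ω) := by
    funext ω; rw [subTable_two_pow]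
  have h0 : (fun ω : pp.HΩ => T.eval (pp.hybTable (j.val + 1) ω)) = fun ω => T.eval (pp.subTable j 0 ω) := by
    funext ω; rw [subTable_zero]
  rw [hN, h0, abs_sub_comm]
  refine abs_uProb_sub_le_mul (fun i (ω : pp.HΩ) => T.eval (pp.subTable j i ω)) (2 ^ pp.n) fun i hi => ?_
  rw [abs_sub_comm]
  exact abs_uProb_subTable_step_le hP hQ hg T hT hε H j hi

/-- **All levels** (the hybrid argument of Thm. 4.1 over `J ∈ [n]`, each level paid `2ⁿ` DDH
advantages): `|Pr[T(hybrid 0)] - Pr[T(hybrid n)]| ≤ n · 2ⁿ · ε`. [cite: NaorReingold2004, proof of Thm. 4.1 (p. 251)] -/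
theorem abs_uProb_hybTable_le [NeZero pp.P] (hP : pp.P ≤ 2 ^ pp.m) (hQ : pp.Q ≤ 2 ^ pp.m)
    (hg : pp.gpow pp.Q = 1) (T : Circuit (Fin (2 ^ pp.n))) (hT : T.IsOver B2) {ε : ℝ} (hε : 0 ≤ ε)
    (H : ∀ C : Circuit (Fin 3 × Fin pp.m), C.IsOver B2 → C.size ≤ pp.simSize T →
      ddhAdvantage pp.m pp.P pp.Q pp.g C ≤ ε) :
    |uProb (fun ω : pp.HΩ => T.eval (pp.hybTable 0 ω)) -
      uProb (fun ω : pp.HΩ => T.eval (pp.hybTable pp.n ω))| ≤ pp.n * ((2 ^ pp.n : ℕ) * ε) :=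
  abs_uProb_sub_le_mul (fun i (ω : pp.HΩ) => T.eval (pp.hybTable i ω)) pp.n fun i hi =>
    abs_uProb_hybTable_succ_le hP hQ hg T hT hε H ⟨i, hi⟩

end Params

end NaorReingold

end Literature.Computability.Cryptography

end
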